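import Summits.BirchSwinnertonDyer.Rank1Residual.X2.RouteGSplitDisplay320775m1
import Summits.BirchSwinnertonDyer.Rank1Residual.X2.CongruenceTransferCoveredRank
import Summits.BirchSwinnertonDyer.Rank1Residual.X2.LayerOneRank213850cw1
import HarnessLib

/-!
# Route G at a NON-SPLIT multiplicative Eisenstein `3` — ROAD T1 display on the pair `320775m1 @ 3 ← 213850cw1 @ 3`, Galois side
# AND the relative's rank growth IN THE KERNEL (cell `bsd-eis`, seat `bsd-eis-k5-c3` g6; THEOREMS ONLY)

HONEST FRAMING (FULL-BSD rank-≤1 programme D-0033, cell `bsd-eis`, home `run/shared/lean/pub/bsd-eis/`; row A10 = corner X2b: 127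
cells `(E₀,3)` (83 split + 44 non-split), `r = 0`, multiplicative Eisenstein `3`, `¬GVPar`; `320775m1` is a NON-split cell of the
CGS25@3-only register — its only congruent relative of record, `213850cw1`, is GOOD at `3`, so the covered display
`X2/RouteGSplitDisplay320775m1.lean` (T-EISRG3C) needs Castella–Grossi–Skinner 2025 Thm. A (`hA`)). Nothing booked, no label moves:
the same pair run through the tree's route G with the relative's Mazur main conjecture supplied by ROUTE T AT LAYER 1 instead of `hA`
(heads `X2.mazurMainConjectureAt_of_rankRelative_of_not_split` / `X2.bsdp_of_rankRelative_rankZero_of_not_split`,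
`X2/CongruenceTransferCoveredRank.lean`). TARGET `W = 320775m1 = [0, -1, 1, -2334389043033, 1372803598460821718]` (`r_an = 0`; NON-split
at `3`; `(μ_an, λ_an) = (0, n)`, `n` SYMBOLIC, certificate inequality `hn`), RELATIVE `W' = 213850cw1 = [1, 1, 0, -3979775, 3054213125]`
(`rank E'(ℚ) = 2`; GOOD ordinary NON-anomalous at `3`; `(μ, λ)_an = (0, n')` symbolic — leg-1 read of record `(0, 4)` with `R₂ = 0`,
kit j274400, so layer 0 (`2 ≤ rank E'(ℚ)`) is NOT enough and the layer-1 certificate is needed), `p = 3`, `S₀ = {2, 5, 7, 13, 47}`.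
KERNEL INPUTS: part 1 `X2/RouteGSplitDisplay320775m1Local.lean` (ellipticity, minimality, reduction types, `TorsionIso W W' 3` by a
Fisher Hesse certificate, `¬Irr(W[3])`), part 2 `X2/RouteGSplitDisplay320775m1.lean` (`good_outside_S₀`, `sum_delta = 0`), and
`X2/LayerOneRank213850cw1.lean`: **`LayerRankGEAt W' 3 1 4`** (`4 ≤ rank E'(ℚ₁)`, `ℚ₁ = ℚ(ζ₉)⁺`: RED-pair rational rank `2` plus the
`ℚ₁`-point `Q = (1125 + 25/3·θ + 25/3·θ², 875 − 125·θ − 2050/3·θ²)` found by Simon 2-descent in Sage (kit j275486), `Q − σQ`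
non-torsion). PER-PAIR CERTIFICATE HYPOTHESES LEFT [instrument]: `hr : r_an(W) = 0` [Cremona] (BSDp display only); `hμ0, hlam :
(μ_an, λ_an)(W) = (0, n)` and `hμ0', hlam' : (0, n')` [engines; symbolic, tied by `hk : k = n' + 0`], and ONE certificate inequality
`hn' : n' ≤ 4` (= `λ'_an ≤ 4`, the kernel rank bound at layer 1; the read of record has `n' = 4`, `n = 4 = k`). REGISTERED FACTS (all
[PUB]; no `_OPEN`, no `@[conjecture]`, NO Castella–Grossi–Skinner, no Schneider): `hWu` Wuthrich 2014 Thm 16 (multiplicative),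
`hW16` Wuthrich 2014 Thm 16 (good ordinary), `hJs hJn hHs hHn` Stein–Wuthrich 2013, `hGZK`, `hpar hmod`, `hT hT'` Tate, `hAm hBm`
GV 2000 §2, `hF` Greenberg 1999, `hGV hA7 hB` GV 2000 §1–2 (good side), `hGS` Greenberg–Stevens; Greenberg LNM 1716 Thm 1.9 enters
PROVED (`Iwasawa/RankGrowthLayerHolds`). NOT: not K5 (MEMO-4-K5); not a booking of `(320775m1, 3)`.
Refs: [GreenbergVatsal2000] Thm (1.4), Prop (2.4); [Wuthrich2014] Thm 16; [SteinWuthrich2013] Thm 6.1; [GreenbergLNM1716] Thm 1.9;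
[Fisher2012Hessian] §13; [SilvermanAEC2009] VII–VIII.
-/

set_option autoImplicit false

noncomputable section

open scoped Classical

open WeierstrassCurve NumberField IsDedekindDomain
  Literature.NumberTheory.EllipticCurves
  Literature.NumberTheory.EllipticCurves.ModularForms
  Literature.NumberTheory.EllipticCurves.Rank1Residual
  Literature.NumberTheory.EllipticCurves.Rank1Residual.Typed
  Literature.NumberTheory.EllipticCurves.Rank1Residual.X11RankOneCertificates
  Literature.NumberTheory.EllipticCurves.Wuthrich2014
  Literature.NumberTheory.EllipticCurves.SteinWuthrich2013
  Literature.NumberTheory.EllipticCurves.Greenberg1999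
  Literature.NumberTheory.EllipticCurves.GreenbergVatsal2000
  Summit.BirchSwinnertonDyer.BirchSwinnertonDyer.Rank1Residual.IntModel
  Summit.BirchSwinnertonDyer.BirchSwinnertonDyer.Rank1Residual.X11RankOne
  Summit.BirchSwinnertonDyer.Rank1Residual.X11b
  Summit.BirchSwinnertonDyer.Rank1Residual.X1.CongruenceTransfer
  Summit.BirchSwinnertonDyer.Rank1Residual.X2.LocalDeltaCalculus
  Summit.BirchSwinnertonDyer.Rank1Residual
  Summit.BirchSwinnertonDyer.Rank1Residual.Iwasawa
  Summit.BirchSwinnertonDyer.Rank1Residual.X2.RouteGSplitDisplay320775m1Local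
  Summit.BirchSwinnertonDyer.Rank1Residual.X2.RouteGSplitDisplay320775m1

namespace Summit.BirchSwinnertonDyer.Rank1Residual.X2.RouteGSplitDisplay320775m1T1

/-! ## §1 `3 ∉ S₀` (part 2 keeps this private; re-derived) -/

/-- **`3 ∉ v` for `v ∈ S₀ = {2, 5, 7, 13, 47}`.** [folklore] -/
private theorem three_not_mem_of_mem_S₀ :
    ∀ v ∈ ({((Rat.HeightOneSpectrum.primesEquiv (R := 𝓞 ℚ)).symm ⟨2, Nat.prime_two⟩),
      ((Rat.HeightOneSpectrum.primesEquiv (R := 𝓞 ℚ)).symm ⟨5, by norm_num⟩),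
      ((Rat.HeightOneSpectrum.primesEquiv (R := 𝓞 ℚ)).symm ⟨7, by norm_num⟩),
      ((Rat.HeightOneSpectrum.primesEquiv (R := 𝓞 ℚ)).symm ⟨13, by norm_num⟩),
      ((Rat.HeightOneSpectrum.primesEquiv (R := 𝓞 ℚ)).symm ⟨47, by norm_num⟩)} : Finset (HeightOneSpectrum (𝓞 ℚ))),
      ((3 : ℕ) : 𝓞 ℚ) ∉ v.asIdeal := by
  intro v hv h3
  have h := Rat.HeightOneSpectrum.primesEquiv_eq_of_natCast_mem v (by norm_num) h3
  have key : ∀ (ℓ : ℕ) (hℓ : ℓ.Prime), v = (Rat.HeightOneSpectrum.primesEquiv (R := 𝓞 ℚ)).symm ⟨ℓ, hℓ⟩ →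
      (Rat.HeightOneSpectrum.primesEquiv (R := 𝓞 ℚ) v : ℕ) = ℓ := fun ℓ hℓ h' ↦ by
    rw [h']; simp only [Equiv.apply_symm_apply]
  simp only [Finset.mem_insert, Finset.mem_singleton] at hv
  rcases hv with h' | h' | h' | h' | h' <;> have := key _ _ h' <;> omega

/-! ## §2 The road-T1 displays -/

/-- **ROUTE G DISPLAY at an Eisenstein `3`, road T1: `X2.MazurMainConjectureAt 320775m1 3`** with NO `hA`: head
`X2.mazurMainConjectureAt_of_rankRelative_of_not_split`, relative `213850cw1` closed by route T at layer 1 from the KERNEL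
certificate `LayerOneRank213850cw1.layerRankGEAt_213850cw1 : LayerRankGEAt W' 3 1 4`; `S₀ = {2, 5, 7, 13, 47}`, shift
`k = n' + 0` (`RouteGSplitDisplay320775m1.sum_delta`, PROVED), certificate inequalities `hn : n ≤ k`, `hn' : n' ≤ 4`; `hiso` / `hred`
PROVED in part 1. CONDITIONAL on the per-pair INSTRUMENT certificates `hμ0`, `hlam`, `hμ0'`, `hlam'` only; class-level binders are
REGISTERED [PUB] facts; nothing booked. [cite: GreenbergVatsal2000, Thm. (1.4), §1 (5)–(7), §2 Prop. (2.4) pp. 20–27]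
[cite: Wuthrich2014, Thm. 16 (p. 397)] [cite: GreenbergLNM1716, Thm. 1.9 (p. 63)] [cite: Fisher2012Hessian, §13] -/
theorem mazurMainConjectureAt_320775m1_at_three_T1
    (hWu : thm16_charIdeal_dvd_multiplicative_of_reducible)
    (hW16 : Wuthrich2014.charIdeal_dvd_padicLFunction)
    (hpar : nonempty_modularParametrizationData)
    (hT : Silverman1994_thmV53_corV54_tateUniformisation.{0})
    (hT' : Silverman1994_thmV53_tateUniformisation.{0})
    (hAm : lambda_nonPrimitive_eq_add_sum_delta_multiplicative)
    (hBm : datumSelmer_divisible_of_finite_torsionBy) (hF : datumStrictSelmer_lt_datumSelmer_of_split)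
    (hGV : imKummer_ge_greenbergCondition_at_p) (hA7 : lambda_nonPrimitive_eq_add_sum_delta)
    (hB : divisible_nonPrimitiveSelmerInfty_of_mu_eq_zero)
    (W W' : WeierstrassCurve ℚ) [W.IsElliptic] [W.IsGloballyMinimal] [W'.IsElliptic]
    [W'.IsGloballyMinimal] (hW : W = ⟨0, -1, 1, -2334389043033, 1372803598460821718⟩)
    (hW' : W' = ⟨1, 1, 0, -3979775, 3054213125⟩)
    (n n' k : ℕ) (hμ0 : AnalyticMuLE W 3 0) (hlam : AnalyticLambdaEq W 3 n)
    (hμ0' : X1.MuPart.AnalyticMuLE W' 3 0) (hlam' : X1.ParitySqueeze.AnalyticLambdaEq W' 3 n')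
    (hk : (k : ℤ) = n' + (0)) (hn : n ≤ k) (hn' : n' ≤ 4) :
    X2.MazurMainConjectureAt W 3 := by
  have hδ := RouteGSplitDisplay320775m1.sum_delta W W' hW hW'
  subst hW hW'
  have hp2 : (3 : ℕ) ≠ 2 := by decide
  obtain ⟨hmult, hns⟩ := nonsplit_320775m1
  obtain ⟨hgood', -⟩ := goodNonAnom_213850cw1
  have hm' : LayerRankGEAt (⟨1, 1, 0, -3979775, 3054213125⟩ : WeierstrassCurve ℚ) 3 1 4 :=
    LayerOneRank213850cw1.layerRankGEAt_213850cw1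
  have hk' : (k : ℤ) = n' + ∑ v ∈ ({((Rat.HeightOneSpectrum.primesEquiv (R := 𝓞 ℚ)).symm ⟨2, Nat.prime_two⟩),
      ((Rat.HeightOneSpectrum.primesEquiv (R := 𝓞 ℚ)).symm ⟨5, by norm_num⟩),
      ((Rat.HeightOneSpectrum.primesEquiv (R := 𝓞 ℚ)).symm ⟨7, by norm_num⟩),
      ((Rat.HeightOneSpectrum.primesEquiv (R := 𝓞 ℚ)).symm ⟨13, by norm_num⟩),
      ((Rat.HeightOneSpectrum.primesEquiv (R := 𝓞 ℚ)).symm ⟨47, by norm_num⟩)} : Finset (HeightOneSpectrum (𝓞 ℚ))),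
      ((delta (⟨1, 1, 0, -3979775, 3054213125⟩ : WeierstrassCurve ℚ) 3 v : ℤ) -
        (delta (⟨0, -1, 1, -2334389043033, 1372803598460821718⟩ : WeierstrassCurve ℚ) 3 v : ℤ)) := by
    rw [hδ]; exact hk
  exact mazurMainConjectureAt_of_rankRelative_of_not_split _ hWu hW16 hpar hT hT' hAm hBm hF hGV hA7 hB
    hp2 hmult hns not_irreducible_320775m1 hμ0 hlam hgood' hμ0' hlam' hm' hn' three_not_mem_of_mem_S₀
    (fun v hv h3 ↦ (RouteGSplitDisplay320775m1.good_outside_S₀ v hv h3).1)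
    (fun v hv h3 ↦ (RouteGSplitDisplay320775m1.good_outside_S₀ v hv h3).2)
    torsionIso_320775m1_213850cw1 hk' hn

/-- **`BSD(320775m1, 3)`, road T1** (the A10 cell's currency) from the same inputs plus Greenberg–Stevens and the rank-`0`
certificate (`X2.bsdp_of_rankRelative_rankZero_of_not_split`; k, n, n' symbolic: `hk`, `hn`, `hn' : n' ≤ 4`); Galois side and the
relative's layer-1 rank growth in the kernel; NO `hA`. CONDITIONAL on the per-pair instrument certificates; nothing booked.
[cite: GreenbergVatsal2000, Thm. (1.4), §2 Prop. (2.4)] [cite: Wuthrich2014, Thm. 16 (p. 397)] [cite: GreenbergLNM1716, Thm. 1.9 (p. 63)]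
[cite: SteinWuthrich2013, Thm. 6.1 (p. 20)] [cite: MazurTateTeitelbaum1986Invent, Ch. II §10 Conjecture (BSD(p)) (p. 38)]
[cite: Miller2011LMS, Def. 1.1] -/
theorem bsdp_320775m1_at_three_T1
    (hWu : thm16_charIdeal_dvd_multiplicative_of_reducible)
    (hW16 : Wuthrich2014.charIdeal_dvd_padicLFunction)
    (hJs : thm61_splitMultiplicative) (hJn : thm61_nonsplitMultiplicative)
    (hHs : exists_isSplitMultCanonical) (hHn : exists_isMultCanonical)
    (hGZK : rank_eq_analyticRank_of_analyticRank_le_one) (hmod : hasEntireLFunction_rat)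
    (hpar : nonempty_modularParametrizationData)
    (hT : Silverman1994_thmV53_corV54_tateUniformisation.{0})
    (hT' : Silverman1994_thmV53_tateUniformisation.{0})
    (hAm : lambda_nonPrimitive_eq_add_sum_delta_multiplicative)
    (hBm : datumSelmer_divisible_of_finite_torsionBy) (hF : datumStrictSelmer_lt_datumSelmer_of_split)
    (hGV : imKummer_ge_greenbergCondition_at_p) (hA7 : lambda_nonPrimitive_eq_add_sum_delta)
    (hB : divisible_nonPrimitiveSelmerInfty_of_mu_eq_zero)
    (W W' : WeierstrassCurve ℚ) [W.IsElliptic] [W.IsGloballyMinimal] [W'.IsElliptic]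
    [W'.IsGloballyMinimal] (hW : W = ⟨0, -1, 1, -2334389043033, 1372803598460821718⟩)
    (hW' : W' = ⟨1, 1, 0, -3979775, 3054213125⟩)
    (hGS : greenberg_stevens (W := W) (p := 3))
    (hr : W.analyticRank = 0)
    (n n' k : ℕ) (hμ0 : AnalyticMuLE W 3 0) (hlam : AnalyticLambdaEq W 3 n)
    (hμ0' : X1.MuPart.AnalyticMuLE W' 3 0) (hlam' : X1.ParitySqueeze.AnalyticLambdaEq W' 3 n')
    (hk : (k : ℤ) = n' + (0)) (hn : n ≤ k) (hn' : n' ≤ 4) :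
    BSDp W 3 := by
  have hδ := RouteGSplitDisplay320775m1.sum_delta W W' hW hW'
  subst hW hW'
  have hp2 : (3 : ℕ) ≠ 2 := by decide
  obtain ⟨hmult, hns⟩ := nonsplit_320775m1
  obtain ⟨hgood', -⟩ := goodNonAnom_213850cw1
  have hm' : LayerRankGEAt (⟨1, 1, 0, -3979775, 3054213125⟩ : WeierstrassCurve ℚ) 3 1 4 :=
    LayerOneRank213850cw1.layerRankGEAt_213850cw1
  have hk' : (k : ℤ) = n' + ∑ v ∈ ({((Rat.HeightOneSpectrum.primesEquiv (R := 𝓞 ℚ)).symm ⟨2, Nat.prime_two⟩),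
      ((Rat.HeightOneSpectrum.primesEquiv (R := 𝓞 ℚ)).symm ⟨5, by norm_num⟩),
      ((Rat.HeightOneSpectrum.primesEquiv (R := 𝓞 ℚ)).symm ⟨7, by norm_num⟩),
      ((Rat.HeightOneSpectrum.primesEquiv (R := 𝓞 ℚ)).symm ⟨13, by norm_num⟩),
      ((Rat.HeightOneSpectrum.primesEquiv (R := 𝓞 ℚ)).symm ⟨47, by norm_num⟩)} : Finset (HeightOneSpectrum (𝓞 ℚ))),
      ((delta (⟨1, 1, 0, -3979775, 3054213125⟩ : WeierstrassCurve ℚ) 3 v : ℤ) -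
        (delta (⟨0, -1, 1, -2334389043033, 1372803598460821718⟩ : WeierstrassCurve ℚ) 3 v : ℤ)) := by
    rw [hδ]; exact hk
  exact bsdp_of_rankRelative_rankZero_of_not_split _ hWu hW16 hJs hJn hHs hHn hGZK hmod hpar hT hT' hAm
    hBm hF hGV hA7 hB _ _ 3 hGS hp2 hmult hns not_irreducible_320775m1 hr hμ0 hlam hgood' hμ0' hlam' hm' hn'
    three_not_mem_of_mem_S₀ (fun v hv h3 ↦ (RouteGSplitDisplay320775m1.good_outside_S₀ v hv h3).1)
    (fun v hv h3 ↦ (RouteGSplitDisplay320775m1.good_outside_S₀ v hv h3).2) torsionIso_320775m1_213850cw1 hk' hn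

end Summit.BirchSwinnertonDyer.Rank1Residual.X2.RouteGSplitDisplay320775m1T1

end
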